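import Summits.AtomisticToContinuum.Crystallization.Theorems.ChessboardParticlePlanesPeriodicWindowsEnvelopeIdent

/-!
# Envelope numerics for `PeriodicWindows` (stmt-AtomisticToContinuum-3240), stub E2b — convexity in `t` and the cell lemmas

Every pattern sum `t ↦ envSum d lo bdd e t` is CONVEX on `t > 0` (termwise: `x ↦ x^{-e}` is convex on
`(0,∞)`, `Mathlib.convexOn_zpow`, and `Q + k² t` is affine in `t`), hence so are the envelopes
`envU e · s`, `envL e · s` for `s ∈ [0,2]`.  On a cell `t = c² ∈ [t₁, t₂]` with an anchor `t₃ > t₂` this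
gives the CHORD upper bound `(t₂-t₁) U(t) ≤ (t₂-t) U(t₁) + (t-t₁) U(t₂)` and the EXTENSION lower bound
`(t₃-t₂) L(t) ≥ (t₃-t) L(t₂) - (t₂-t) L(t₃)`; both are affine in `t`, so the target inequalities
`U₃² ≤ (86/5) L₆` (a parabola against a line) and `(47/50)⁶ U₃ ≤ L₆`, `U₆ ≤ L₃` hold on the whole cell
as soon as they hold — for the certified endpoint data — at `t₁` and `t₂` (`env_cell1`, `env_cell2`).
The cell lemmas consume the grid certificates in the flat ten-conjunct shape of `…EnvelopeGrid*`. [folklore]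
-/

noncomputable section

namespace Summit.AtomisticToContinuum.Crystallization.Theorems.PeriodicWindowsSketch

open Finset Summit.AtomisticToContinuum.Crystallization.Theorems.ExcessDecayLiouvilleCoarseGrains
open Literature.MathematicalPhysics.StatisticalMechanics

/-! ## Convexity in `t` -/

/-- Two-point convexity of `x ↦ x^{-e}` on `(0, ∞)`. [folklore] -/
theorem env_inv_pow_convex (e : ℕ) {X Y : ℝ} (hX : 0 < X) (hY : 0 < Y) {a b : ℝ} (ha : 0 ≤ a) (hb : 0 ≤ b)
    (hab : a + b = 1) : ((a * X + b * Y)⁻¹) ^ e ≤ a * (X⁻¹) ^ e + b * (Y⁻¹) ^ e := by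
  have h := (convexOn_zpow (-(e : ℤ)) : ConvexOn ℝ (Set.Ioi (0 : ℝ)) fun x : ℝ => x ^ (-(e : ℤ))).2
    (Set.mem_Ioi.2 hX) (Set.mem_Ioi.2 hY) ha hb hab
  simp only [smul_eq_mul, zpow_neg, zpow_natCast] at h
  simpa only [inv_pow] using h

/-- Two-point convexity of every pattern term in `t > 0` (`d ∈ {0,1}`). [folklore] -/
theorem envTerm_convex {d : ℕ} (hd : d = 0 ∨ d = 1) (lo : ℕ) (bdd : Bool) (e : ℕ) {x y : ℝ} (hx : 0 < x)
    (hy : 0 < y) {a b : ℝ} (ha : 0 ≤ a) (hb : 0 ≤ b) (hab : a + b = 1) (v : ℤ × ℤ × ℤ) :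
    envTerm d lo bdd e (a * x + b * y) v ≤ a * envTerm d lo bdd e x v + b * envTerm d lo bdd e y v := by
  unfold envTerm
  split_ifs with hv
  · obtain ⟨k, i, j⟩ := v
    dsimp only
    have hX := env_r_pos hd hv.2.2 hx
    have hY := env_r_pos hd hv.2.2 hy
    have key := env_inv_pow_convex e hX hY ha hb hab
    have hlin : hcpSumQ ((d : ℤ), i, j) + (k : ℝ) ^ 2 * (a * x + b * y) =
        a * (hcpSumQ ((d : ℤ), i, j) + (k : ℝ) ^ 2 * x) + b * (hcpSumQ ((d : ℤ), i, j) + (k : ℝ) ^ 2 * y) := by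
      linear_combination (-(hcpSumQ ((d : ℤ), i, j))) * hab
    rw [hlin]
    exact key
  · simp

/-- A convex combination of positive reals is positive. [folklore] -/
theorem env_convex_comb_pos {x y a b : ℝ} (hx : 0 < x) (hy : 0 < y) (ha : 0 ≤ a) (hb : 0 ≤ b) (hab : a + b = 1) :
    0 < a * x + b * y := by
  nlinarith [lt_min hx hy, min_le_left x y, min_le_right x y, mul_nonneg ha (sub_nonneg.2 (min_le_left x y)),
    mul_nonneg hb (sub_nonneg.2 (min_le_right x y))]

/-- **Two-point convexity of the pattern sums** in `t > 0` (`e ≥ 3`, `d ∈ {0,1}`). [folklore] -/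
theorem envSum_convex {d : ℕ} (hd : d = 0 ∨ d = 1) (lo : ℕ) (bdd : Bool) {e : ℕ} (he : 3 ≤ e) {x y : ℝ}
    (hx : 0 < x) (hy : 0 < y) {a b : ℝ} (ha : 0 ≤ a) (hb : 0 ≤ b) (hab : a + b = 1) :
    envSum d lo bdd e (a * x + b * y) ≤ a * envSum d lo bdd e x + b * envSum d lo bdd e y := by
  unfold envSum
  have hsx := envTerm_summable d lo bdd he hx
  have hsy := envTerm_summable d lo bdd he hy
  have hsxy := envTerm_summable d lo bdd he (env_convex_comb_pos hx hy ha hb hab)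
  calc ∑' v, envTerm d lo bdd e (a * x + b * y) v
      ≤ ∑' v, (a * envTerm d lo bdd e x v + b * envTerm d lo bdd e y v) :=
        hsxy.tsum_le_tsum (fun v => envTerm_convex hd lo bdd e hx hy ha hb hab v)
          ((hsx.mul_left a).add (hsy.mul_left b))
    _ = a * ∑' v, envTerm d lo bdd e x v + b * ∑' v, envTerm d lo bdd e y v := by
        rw [(hsx.mul_left a).tsum_add (hsy.mul_left b), hsx.tsum_mul_left a, hsy.tsum_mul_left b]

/-- **Two-point convexity of the upper envelope** (`s ∈ [0,2]`). [folklore] -/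
theorem envU_convex {e : ℕ} (he : 3 ≤ e) {x y : ℝ} (hx : 0 < x) (hy : 0 < y) {a b : ℝ} (ha : 0 ≤ a) (hb : 0 ≤ b)
    (hab : a + b = 1) {s : ℝ} (hs0 : 0 ≤ s) (hs2 : s ≤ 2) :
    envU e (a * x + b * y) s ≤ a * envU e x s + b * envU e y s := by
  unfold envU
  have h1 := envSum_convex (Or.inr rfl) 1 true he hx hy ha hb hab
  have h2 := envSum_convex (Or.inl rfl) 3 false he hx hy ha hb hab
  have h3 := mul_le_mul_of_nonneg_left (envSum_convex (Or.inr rfl) 2 true he hx hy ha hb hab) (sub_nonneg.2 hs2)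
  have h4 := mul_le_mul_of_nonneg_left (envSum_convex (Or.inl rfl) 2 true he hx hy ha hb hab) hs0
  have hI : envIn e = a * envIn e + b * envIn e := by rw [← add_mul, hab, one_mul]
  linarith

/-- **Two-point convexity of the lower envelope** (`s ∈ [0,2]`). [folklore] -/
theorem envL_convex {e : ℕ} (he : 3 ≤ e) {x y : ℝ} (hx : 0 < x) (hy : 0 < y) {a b : ℝ} (ha : 0 ≤ a) (hb : 0 ≤ b)
    (hab : a + b = 1) {s : ℝ} (hs0 : 0 ≤ s) (hs2 : s ≤ 2) :
    envL e (a * x + b * y) s ≤ a * envL e x s + b * envL e y s := by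
  unfold envL
  have h1 := envSum_convex (Or.inr rfl) 1 true he hx hy ha hb hab
  have h2 := envSum_convex (Or.inr rfl) 3 false he hx hy ha hb hab
  have h3 := mul_le_mul_of_nonneg_left (envSum_convex (Or.inr rfl) 2 true he hx hy ha hb hab) (sub_nonneg.2 hs2)
  have h4 := mul_le_mul_of_nonneg_left (envSum_convex (Or.inl rfl) 2 true he hx hy ha hb hab) hs0
  have hI : envIn e = a * envIn e + b * envIn e := by rw [← add_mul, hab, one_mul]
  linarith

/-- **Chord bound** for the upper envelope on `[t₁, t₂]`:
`(t₂-t₁) U(t) ≤ (t₂-t) U(t₁) + (t-t₁) U(t₂)`. [folklore] -/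
theorem envU_chord {e : ℕ} (he : 3 ≤ e) {t₁ t₂ t : ℝ} (h0 : 0 < t₁) (h12 : t₁ < t₂) (ht1 : t₁ ≤ t) (ht2 : t ≤ t₂)
    {s : ℝ} (hs0 : 0 ≤ s) (hs2 : s ≤ 2) :
    (t₂ - t₁) * envU e t s ≤ (t₂ - t) * envU e t₁ s + (t - t₁) * envU e t₂ s := by
  have hD : 0 < t₂ - t₁ := by linarith
  set a : ℝ := (t₂ - t) / (t₂ - t₁) with ha_def
  set b : ℝ := (t - t₁) / (t₂ - t₁) with hb_def
  have ha : 0 ≤ a := div_nonneg (by linarith) hD.le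
  have hb : 0 ≤ b := div_nonneg (by linarith) hD.le
  have hab : a + b = 1 := by rw [ha_def, hb_def, ← add_div, div_eq_one_iff_eq hD.ne']; ring
  have ht : a * t₁ + b * t₂ = t := by rw [ha_def, hb_def]; field_simp; ring
  have h := envU_convex he h0 (h0.trans h12) ha hb hab hs0 hs2
  rw [ht] at h
  have e1 : (t₂ - t₁) * a = t₂ - t := by rw [ha_def]; field_simp
  have e2 : (t₂ - t₁) * b = t - t₁ := by rw [hb_def]; field_simp
  calc (t₂ - t₁) * envU e t s ≤ (t₂ - t₁) * (a * envU e t₁ s + b * envU e t₂ s) :=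
        mul_le_mul_of_nonneg_left h hD.le
    _ = (t₂ - t₁) * a * envU e t₁ s + (t₂ - t₁) * b * envU e t₂ s := by ring
    _ = _ := by rw [e1, e2]

/-- **Extension bound** for the lower envelope: for `0 < t ≤ t₂ < t₃`,
`(t₃-t) L(t₂) ≤ (t₃-t₂) L(t) + (t₂-t) L(t₃)`. [folklore] -/
theorem envL_ext {e : ℕ} (he : 3 ≤ e) {t t₂ t₃ : ℝ} (h0 : 0 < t) (ht2 : t ≤ t₂) (h23 : t₂ < t₃)
    {s : ℝ} (hs0 : 0 ≤ s) (hs2 : s ≤ 2) :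
    (t₃ - t) * envL e t₂ s ≤ (t₃ - t₂) * envL e t s + (t₂ - t) * envL e t₃ s := by
  have hD : 0 < t₃ - t := by linarith
  set a : ℝ := (t₃ - t₂) / (t₃ - t) with ha_def
  set b : ℝ := (t₂ - t) / (t₃ - t) with hb_def
  have ha : 0 ≤ a := div_nonneg (by linarith) hD.le
  have hb : 0 ≤ b := div_nonneg (by linarith) hD.le
  have hab : a + b = 1 := by rw [ha_def, hb_def, ← add_div, div_eq_one_iff_eq hD.ne']; ring
  have ht : a * t + b * t₃ = t₂ := by rw [ha_def, hb_def]; field_simp; ring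
  have h := envL_convex he h0 (show (0 : ℝ) < t₃ by linarith) ha hb hab hs0 hs2
  rw [ht] at h
  have e1 : (t₃ - t) * a = t₃ - t₂ := by rw [ha_def]; field_simp
  have e2 : (t₃ - t) * b = t₂ - t := by rw [hb_def]; field_simp
  calc (t₃ - t) * envL e t₂ s ≤ (t₃ - t) * (a * envL e t s + b * envL e t₃ s) :=
        mul_le_mul_of_nonneg_left h hD.le
    _ = (t₃ - t) * a * envL e t s + (t₃ - t) * b * envL e t₃ s := by ring
    _ = _ := by rw [e1, e2]

/-! ## Aggregating piece bounds -/

/-- Upper bound of the upper envelope from upper piece bounds (`s ∈ [0,2]`). [folklore] -/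
theorem envU_le_of_bounds {e : ℕ} {t s I f l p a : ℝ} (hs0 : 0 ≤ s) (hs2 : s ≤ 2) (hI : envIn e ≤ I)
    (hf : envSum 1 1 true e t ≤ f) (hl : envSum 0 3 false e t ≤ l) (hp : envSum 1 2 true e t ≤ p)
    (ha : envSum 0 2 true e t ≤ a) : envU e t s ≤ I + 2 * f + 2 * l + (2 - s) * p + s * a := by
  unfold envU
  nlinarith [mul_le_mul_of_nonneg_left hp (sub_nonneg.2 hs2), mul_le_mul_of_nonneg_left ha hs0]

/-- Lower bound of the lower envelope from lower piece bounds (`s ∈ [0,2]`). [folklore] -/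
theorem env_le_envL_of_bounds {e : ℕ} {t s I f S p a : ℝ} (hs0 : 0 ≤ s) (hs2 : s ≤ 2) (hI : I ≤ envIn e)
    (hf : f ≤ envSum 1 1 true e t) (hS : S ≤ envSum 1 3 false e t) (hp : p ≤ envSum 1 2 true e t)
    (ha : a ≤ envSum 0 2 true e t) : I + 2 * f + 2 * S + (2 - s) * p + s * a ≤ envL e t s := by
  unfold envL
  nlinarith [mul_le_mul_of_nonneg_left hp (sub_nonneg.2 hs2), mul_le_mul_of_nonneg_left ha hs0]

/-- Upper bound of the lower envelope from upper piece bounds (`s ∈ [0,2]`). [folklore] -/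
theorem envL_le_of_bounds {e : ℕ} {t s I f S p a : ℝ} (hs0 : 0 ≤ s) (hs2 : s ≤ 2) (hI : envIn e ≤ I)
    (hf : envSum 1 1 true e t ≤ f) (hS : envSum 1 3 false e t ≤ S) (hp : envSum 1 2 true e t ≤ p)
    (ha : envSum 0 2 true e t ≤ a) : envL e t s ≤ I + 2 * f + 2 * S + (2 - s) * p + s * a := by
  unfold envL
  nlinarith [mul_le_mul_of_nonneg_left hp (sub_nonneg.2 hs2), mul_le_mul_of_nonneg_left ha hs0]

/-- The upper envelope is nonnegative (`t ≥ 0`, `s ∈ [0,2]`). [folklore] -/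
theorem envU_nonneg (e : ℕ) {t s : ℝ} (ht : 0 ≤ t) (hs0 : 0 ≤ s) (hs2 : s ≤ 2) : 0 ≤ envU e t s := by
  unfold envU envIn
  have h0 := envSum_nonneg 0 0 true e (le_refl (0 : ℝ))
  have h1 := envSum_nonneg 1 1 true e ht
  have h2 := envSum_nonneg 0 3 false e ht
  have h3 := mul_nonneg (sub_nonneg.2 hs2) (envSum_nonneg 1 2 true e ht)
  have h4 := mul_nonneg hs0 (envSum_nonneg 0 2 true e ht)
  linarith

/-! ## The two real-variable cores -/

/-- **Quadratic core**: chord data for `u`, extension data for `L`, and the two endpoint checks give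
`u² ≤ K L` at the interior point. [folklore] -/
theorem env_sq_core {u L U₁ U₂ Lm Lp t t₁ t₂ t₃ K : ℝ} (h12 : t₁ < t₂) (h23 : t₂ < t₃) (ht1 : t₁ ≤ t)
    (ht2 : t ≤ t₂) (hu : 0 ≤ u) (hK : 0 ≤ K)
    (hchord : (t₂ - t₁) * u ≤ (t₂ - t) * U₁ + (t - t₁) * U₂)
    (hext : (t₃ - t) * Lm - (t₂ - t) * Lp ≤ (t₃ - t₂) * L)
    (c2 : U₂ ^ 2 ≤ K * Lm) (c1 : U₁ ^ 2 * (t₃ - t₂) ≤ K * ((t₃ - t₂) * Lm + (t₂ - t₁) * (Lm - Lp))) :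
    u ^ 2 ≤ K * L := by
  have hD1 : 0 < t₂ - t₁ := by linarith
  have hD2 : 0 < t₃ - t₂ := by linarith
  have hα : 0 ≤ t₂ - t := by linarith
  have hβ : 0 ≤ t - t₁ := by linarith
  set W : ℝ := (t₂ - t) * U₁ ^ 2 + (t - t₁) * U₂ ^ 2 with hW
  -- Step A/B: (t₂ - t₁) u² ≤ W
  have hAB : (t₂ - t₁) * u ^ 2 ≤ W := by
    have hA : ((t₂ - t₁) * u) ^ 2 ≤ ((t₂ - t) * U₁ + (t - t₁) * U₂) ^ 2 :=
      pow_le_pow_left₀ (by positivity) hchord 2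
    have hB : ((t₂ - t) * U₁ + (t - t₁) * U₂) ^ 2 ≤ (t₂ - t₁) * W := by
      have : (t₂ - t₁) * W - ((t₂ - t) * U₁ + (t - t₁) * U₂) ^ 2 = (t₂ - t) * (t - t₁) * (U₁ - U₂) ^ 2 := by
        rw [hW]; ring
      nlinarith [mul_nonneg (mul_nonneg hα hβ) (sq_nonneg (U₁ - U₂))]
    have h3 : (t₂ - t₁) * ((t₂ - t₁) * u ^ 2) ≤ (t₂ - t₁) * W := by
      calc (t₂ - t₁) * ((t₂ - t₁) * u ^ 2) = ((t₂ - t₁) * u) ^ 2 := by ring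
        _ ≤ _ := hA.trans hB
    exact le_of_mul_le_mul_left h3 hD1
  -- Step C/D: (t₃ - t₂) W ≤ K (t₂ - t₁) ((t₃ - t₂) Lm + (t₂ - t)(Lm - Lp))
  have hCD : (t₃ - t₂) * W ≤ K * ((t₂ - t₁) * ((t₃ - t₂) * Lm + (t₂ - t) * (Lm - Lp))) := by
    have h1 := mul_le_mul_of_nonneg_left c1 hα
    have h2 := mul_le_mul_of_nonneg_left c2 (mul_nonneg hβ hD2.le)
    have : (t₃ - t₂) * W = (t₂ - t) * (U₁ ^ 2 * (t₃ - t₂)) + (t - t₁) * (t₃ - t₂) * U₂ ^ 2 := by rw [hW]; ring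
    rw [this]
    nlinarith
  -- Step E: (t₃ - t₂) Lm + (t₂ - t)(Lm - Lp) ≤ (t₃ - t₂) L
  have hE : (t₃ - t₂) * Lm + (t₂ - t) * (Lm - Lp) ≤ (t₃ - t₂) * L := by linarith
  have hfin : (t₂ - t₁) * (t₃ - t₂) * u ^ 2 ≤ (t₂ - t₁) * (t₃ - t₂) * (K * L) := by
    calc (t₂ - t₁) * (t₃ - t₂) * u ^ 2 = (t₃ - t₂) * ((t₂ - t₁) * u ^ 2) := by ring
      _ ≤ (t₃ - t₂) * W := mul_le_mul_of_nonneg_left hAB hD2.le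
      _ ≤ K * ((t₂ - t₁) * ((t₃ - t₂) * Lm + (t₂ - t) * (Lm - Lp))) := hCD
      _ = K * (t₂ - t₁) * ((t₃ - t₂) * Lm + (t₂ - t) * (Lm - Lp)) := by ring
      _ ≤ K * (t₂ - t₁) * ((t₃ - t₂) * L) := mul_le_mul_of_nonneg_left hE (by positivity)
      _ = _ := by ring
  exact le_of_mul_le_mul_left hfin (by positivity)

/-- **Linear core**: chord data for `u`, extension data for `L`, and the two endpoint checks give
`k u ≤ L` at the interior point. [folklore] -/
theorem env_lin_core {u L U₁ U₂ Lm Lp t t₁ t₂ t₃ k : ℝ} (h12 : t₁ < t₂) (h23 : t₂ < t₃) (ht1 : t₁ ≤ t)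
    (ht2 : t ≤ t₂) (hk : 0 ≤ k)
    (hchord : (t₂ - t₁) * u ≤ (t₂ - t) * U₁ + (t - t₁) * U₂)
    (hext : (t₃ - t) * Lm - (t₂ - t) * Lp ≤ (t₃ - t₂) * L)
    (c2 : k * U₂ ≤ Lm) (c1 : k * U₁ * (t₃ - t₂) ≤ (t₃ - t₂) * Lm + (t₂ - t₁) * (Lm - Lp)) :
    k * u ≤ L := by
  have hD1 : 0 < t₂ - t₁ := by linarith
  have hD2 : 0 < t₃ - t₂ := by linarith
  have h1 := mul_le_mul_of_nonneg_left c1 (show 0 ≤ t₂ - t by linarith)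
  have h2 := mul_le_mul_of_nonneg_left c2 (mul_nonneg (show 0 ≤ t - t₁ by linarith) hD2.le)
  have h3 := mul_le_mul_of_nonneg_left hchord (mul_nonneg hk hD2.le)
  have hE : (t₃ - t₂) * Lm + (t₂ - t) * (Lm - Lp) ≤ (t₃ - t₂) * L := by linarith
  have hfin : (t₂ - t₁) * (t₃ - t₂) * (k * u) ≤ (t₂ - t₁) * (t₃ - t₂) * L := by nlinarith
  exact le_of_mul_le_mul_left hfin (by positivity)

/-! ## The cell lemmas -/

/-- `p, q ∈ {0,1}` give `s = p + q ∈ {0,1,2} ⊆ [0,2]`. [folklore] -/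
theorem env_s_cases {p q : ℝ} (hp : p = 0 ∨ p = 1) (hq : q = 0 ∨ q = 1) :
    (p + q = 0 ∨ p + q = 1 ∨ p + q = 2) ∧ 0 ≤ p + q ∧ p + q ≤ 2 := by
  rcases hp with rfl | rfl <;> rcases hq with rfl | rfl <;> norm_num

/-- **Cell lemma, part (1)**: on a cell `c² ∈ [t₁, t₂]` (anchor `t₃`), the certified piece bounds at
`t₁` (upper, `e = 3`), `t₂` (upper `e = 3`, lower `e = 6`), `t₃` (upper, `e = 6`) and the in-layer
bounds, together with the two endpoint checks for each `s ∈ {0,1,2}`, give `U₃² ≤ (86/5) L₆`. [folklore] -/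
theorem env_cell1 {t₁ t₂ t₃ : ℝ} (h0 : 0 < t₁) (h12 : t₁ < t₂) (h23 : t₂ < t₃)
    {I3l I3h I6l I6h : ℝ} (hI : I3l ≤ envIn 3 ∧ envIn 3 ≤ I3h ∧ I6l ≤ envIn 6 ∧ envIn 6 ≤ I6h)
    {f1l f1h p1l p1h a1l a1h s1l s1h l1l l1h : ℝ}
    (G1 : f1l ≤ envSum 1 1 true 3 t₁ ∧ envSum 1 1 true 3 t₁ ≤ f1h ∧ p1l ≤ envSum 1 2 true 3 t₁ ∧
      envSum 1 2 true 3 t₁ ≤ p1h ∧ a1l ≤ envSum 0 2 true 3 t₁ ∧ envSum 0 2 true 3 t₁ ≤ a1h ∧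
      s1l ≤ envSum 1 3 false 3 t₁ ∧ envSum 1 3 false 3 t₁ ≤ s1h ∧ l1l ≤ envSum 0 3 false 3 t₁ ∧
      envSum 0 3 false 3 t₁ ≤ l1h)
    {f2l f2h p2l p2h a2l a2h s2l s2h l2l l2h : ℝ}
    (G2 : f2l ≤ envSum 1 1 true 3 t₂ ∧ envSum 1 1 true 3 t₂ ≤ f2h ∧ p2l ≤ envSum 1 2 true 3 t₂ ∧
      envSum 1 2 true 3 t₂ ≤ p2h ∧ a2l ≤ envSum 0 2 true 3 t₂ ∧ envSum 0 2 true 3 t₂ ≤ a2h ∧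
      s2l ≤ envSum 1 3 false 3 t₂ ∧ envSum 1 3 false 3 t₂ ≤ s2h ∧ l2l ≤ envSum 0 3 false 3 t₂ ∧
      envSum 0 3 false 3 t₂ ≤ l2h)
    {F2l F2h P2l P2h A2l A2h S2l S2h L2l L2h : ℝ}
    (H2 : F2l ≤ envSum 1 1 true 6 t₂ ∧ envSum 1 1 true 6 t₂ ≤ F2h ∧ P2l ≤ envSum 1 2 true 6 t₂ ∧
      envSum 1 2 true 6 t₂ ≤ P2h ∧ A2l ≤ envSum 0 2 true 6 t₂ ∧ envSum 0 2 true 6 t₂ ≤ A2h ∧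
      S2l ≤ envSum 1 3 false 6 t₂ ∧ envSum 1 3 false 6 t₂ ≤ S2h ∧ L2l ≤ envSum 0 3 false 6 t₂ ∧
      envSum 0 3 false 6 t₂ ≤ L2h)
    {F3l F3h P3l P3h A3l A3h S3l S3h L3l L3h : ℝ}
    (H3 : F3l ≤ envSum 1 1 true 6 t₃ ∧ envSum 1 1 true 6 t₃ ≤ F3h ∧ P3l ≤ envSum 1 2 true 6 t₃ ∧
      envSum 1 2 true 6 t₃ ≤ P3h ∧ A3l ≤ envSum 0 2 true 6 t₃ ∧ envSum 0 2 true 6 t₃ ≤ A3h ∧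
      S3l ≤ envSum 1 3 false 6 t₃ ∧ envSum 1 3 false 6 t₃ ≤ S3h ∧ L3l ≤ envSum 0 3 false 6 t₃ ∧
      envSum 0 3 false 6 t₃ ≤ L3h)
    (chk : ∀ s : ℝ, (s = 0 ∨ s = 1 ∨ s = 2) →
      (I3h + 2 * f2h + 2 * l2h + (2 - s) * p2h + s * a2h) ^ 2 ≤
          86 / 5 * (I6l + 2 * F2l + 2 * S2l + (2 - s) * P2l + s * A2l) ∧
        (I3h + 2 * f1h + 2 * l1h + (2 - s) * p1h + s * a1h) ^ 2 * (t₃ - t₂) ≤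
          86 / 5 * ((t₃ - t₂) * (I6l + 2 * F2l + 2 * S2l + (2 - s) * P2l + s * A2l) +
            (t₂ - t₁) * ((I6l + 2 * F2l + 2 * S2l + (2 - s) * P2l + s * A2l) -
              (I6h + 2 * F3h + 2 * S3h + (2 - s) * P3h + s * A3h))))
    (c : ℝ) (hc : 0 < c) (hc1 : t₁ ≤ c ^ 2) (hc2 : c ^ 2 ≤ t₂) (p q : ℝ) (hp : p = 0 ∨ p = 1)
    (hq : q = 0 ∨ q = 1) :
    (2 * barlowBaseEnergy (fun r => (r ^ 2)⁻¹ ^ 3) 1 c + (p + q) * barlowCoupling (fun r => (r ^ 2)⁻¹ ^ 3) 1 c 2 +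
        2 * ∑' k : ℕ, barlowCoupling (fun r => (r ^ 2)⁻¹ ^ 3) 1 c (k + 3)) ^ 2 ≤
      (86 / 5) * (2 * barlowBaseEnergy (fun r => (r ^ 2)⁻¹ ^ 6) 1 c +
        (p + q) * barlowCoupling (fun r => (r ^ 2)⁻¹ ^ 6) 1 c 2) := by
  obtain ⟨hs, hs0, hs2⟩ := env_s_cases hp hq
  obtain ⟨c2, c1⟩ := chk (p + q) hs
  rw [env_U_eq (n := 3) le_rfl hc, env_L_eq (n := 6) (by norm_num) hc]
  set t := c ^ 2 with ht
  have ht0 : 0 < t := by positivity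
  have h3 : (3 : ℕ) ≤ 3 := le_rfl
  have h6 : (3 : ℕ) ≤ 6 := by norm_num
  have hU1 := envU_le_of_bounds (e := 3) hs0 hs2 hI.2.1 G1.2.1 G1.2.2.2.2.2.2.2.2.2 G1.2.2.2.1 G1.2.2.2.2.2.1
  have hU2 := envU_le_of_bounds (e := 3) hs0 hs2 hI.2.1 G2.2.1 G2.2.2.2.2.2.2.2.2.2 G2.2.2.2.1 G2.2.2.2.2.2.1
  have hL2 := env_le_envL_of_bounds (e := 6) hs0 hs2 hI.2.2.1 H2.1 H2.2.2.2.2.2.2.1 H2.2.2.1 H2.2.2.2.2.1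
  have hL3 := envL_le_of_bounds (e := 6) hs0 hs2 hI.2.2.2 H3.2.1 H3.2.2.2.2.2.2.2.1 H3.2.2.2.1 H3.2.2.2.2.2.1
  have hch := envU_chord h3 h0 h12 hc1 hc2 hs0 hs2
  have hex := envL_ext h6 ht0 hc2 h23 hs0 hs2
  have hα : 0 ≤ t₂ - t := by linarith
  have hβ : 0 ≤ t - t₁ := by linarith
  have hγ : 0 ≤ t₃ - t := by linarith
  refine env_sq_core h12 h23 hc1 hc2 (envU_nonneg 3 ht0.le hs0 hs2) (by norm_num) ?_ ?_ c2 c1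
  · calc (t₂ - t₁) * envU 3 t (p + q) ≤ (t₂ - t) * envU 3 t₁ (p + q) + (t - t₁) * envU 3 t₂ (p + q) := hch
      _ ≤ _ := add_le_add (mul_le_mul_of_nonneg_left hU1 hα) (mul_le_mul_of_nonneg_left hU2 hβ)
  · have h1 := mul_le_mul_of_nonneg_left hL2 hγ
    have h2 := mul_le_mul_of_nonneg_left hL3 hα
    linarith

/-- **Cell lemma, part (2)**: on a cell `c² ∈ [t₁, t₂]` (anchor `t₃`) the certified piece bounds for
both exponents at the three points and the four endpoint checks for each `s ∈ {0,1,2}` give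
`(47/50)⁶ U₃ ≤ L₆` and `U₆ ≤ L₃`. [folklore] -/
theorem env_cell2 {t₁ t₂ t₃ : ℝ} (h0 : 0 < t₁) (h12 : t₁ < t₂) (h23 : t₂ < t₃)
    {I3l I3h I6l I6h : ℝ} (hI : I3l ≤ envIn 3 ∧ envIn 3 ≤ I3h ∧ I6l ≤ envIn 6 ∧ envIn 6 ≤ I6h)
    {f1l f1h p1l p1h a1l a1h s1l s1h l1l l1h : ℝ}
    (G1 : f1l ≤ envSum 1 1 true 3 t₁ ∧ envSum 1 1 true 3 t₁ ≤ f1h ∧ p1l ≤ envSum 1 2 true 3 t₁ ∧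
      envSum 1 2 true 3 t₁ ≤ p1h ∧ a1l ≤ envSum 0 2 true 3 t₁ ∧ envSum 0 2 true 3 t₁ ≤ a1h ∧
      s1l ≤ envSum 1 3 false 3 t₁ ∧ envSum 1 3 false 3 t₁ ≤ s1h ∧ l1l ≤ envSum 0 3 false 3 t₁ ∧
      envSum 0 3 false 3 t₁ ≤ l1h)
    {F1l F1h P1l P1h A1l A1h S1l S1h L1l L1h : ℝ}
    (H1 : F1l ≤ envSum 1 1 true 6 t₁ ∧ envSum 1 1 true 6 t₁ ≤ F1h ∧ P1l ≤ envSum 1 2 true 6 t₁ ∧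
      envSum 1 2 true 6 t₁ ≤ P1h ∧ A1l ≤ envSum 0 2 true 6 t₁ ∧ envSum 0 2 true 6 t₁ ≤ A1h ∧
      S1l ≤ envSum 1 3 false 6 t₁ ∧ envSum 1 3 false 6 t₁ ≤ S1h ∧ L1l ≤ envSum 0 3 false 6 t₁ ∧
      envSum 0 3 false 6 t₁ ≤ L1h)
    {f2l f2h p2l p2h a2l a2h s2l s2h l2l l2h : ℝ}
    (G2 : f2l ≤ envSum 1 1 true 3 t₂ ∧ envSum 1 1 true 3 t₂ ≤ f2h ∧ p2l ≤ envSum 1 2 true 3 t₂ ∧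
      envSum 1 2 true 3 t₂ ≤ p2h ∧ a2l ≤ envSum 0 2 true 3 t₂ ∧ envSum 0 2 true 3 t₂ ≤ a2h ∧
      s2l ≤ envSum 1 3 false 3 t₂ ∧ envSum 1 3 false 3 t₂ ≤ s2h ∧ l2l ≤ envSum 0 3 false 3 t₂ ∧
      envSum 0 3 false 3 t₂ ≤ l2h)
    {F2l F2h P2l P2h A2l A2h S2l S2h L2l L2h : ℝ}
    (H2 : F2l ≤ envSum 1 1 true 6 t₂ ∧ envSum 1 1 true 6 t₂ ≤ F2h ∧ P2l ≤ envSum 1 2 true 6 t₂ ∧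
      envSum 1 2 true 6 t₂ ≤ P2h ∧ A2l ≤ envSum 0 2 true 6 t₂ ∧ envSum 0 2 true 6 t₂ ≤ A2h ∧
      S2l ≤ envSum 1 3 false 6 t₂ ∧ envSum 1 3 false 6 t₂ ≤ S2h ∧ L2l ≤ envSum 0 3 false 6 t₂ ∧
      envSum 0 3 false 6 t₂ ≤ L2h)
    {f3l f3h p3l p3h a3l a3h s3l s3h l3l l3h : ℝ}
    (G3 : f3l ≤ envSum 1 1 true 3 t₃ ∧ envSum 1 1 true 3 t₃ ≤ f3h ∧ p3l ≤ envSum 1 2 true 3 t₃ ∧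
      envSum 1 2 true 3 t₃ ≤ p3h ∧ a3l ≤ envSum 0 2 true 3 t₃ ∧ envSum 0 2 true 3 t₃ ≤ a3h ∧
      s3l ≤ envSum 1 3 false 3 t₃ ∧ envSum 1 3 false 3 t₃ ≤ s3h ∧ l3l ≤ envSum 0 3 false 3 t₃ ∧
      envSum 0 3 false 3 t₃ ≤ l3h)
    {F3l F3h P3l P3h A3l A3h S3l S3h L3l L3h : ℝ}
    (H3 : F3l ≤ envSum 1 1 true 6 t₃ ∧ envSum 1 1 true 6 t₃ ≤ F3h ∧ P3l ≤ envSum 1 2 true 6 t₃ ∧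
      envSum 1 2 true 6 t₃ ≤ P3h ∧ A3l ≤ envSum 0 2 true 6 t₃ ∧ envSum 0 2 true 6 t₃ ≤ A3h ∧
      S3l ≤ envSum 1 3 false 6 t₃ ∧ envSum 1 3 false 6 t₃ ≤ S3h ∧ L3l ≤ envSum 0 3 false 6 t₃ ∧
      envSum 0 3 false 6 t₃ ≤ L3h)
    (chk : ∀ s : ℝ, (s = 0 ∨ s = 1 ∨ s = 2) →
      (47 / 50 : ℝ) ^ 6 * (I3h + 2 * f2h + 2 * l2h + (2 - s) * p2h + s * a2h) ≤
          I6l + 2 * F2l + 2 * S2l + (2 - s) * P2l + s * A2l ∧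
        (47 / 50 : ℝ) ^ 6 * (I3h + 2 * f1h + 2 * l1h + (2 - s) * p1h + s * a1h) * (t₃ - t₂) ≤
          (t₃ - t₂) * (I6l + 2 * F2l + 2 * S2l + (2 - s) * P2l + s * A2l) +
            (t₂ - t₁) * ((I6l + 2 * F2l + 2 * S2l + (2 - s) * P2l + s * A2l) -
              (I6h + 2 * F3h + 2 * S3h + (2 - s) * P3h + s * A3h)) ∧
        1 * (I6h + 2 * F2h + 2 * L2h + (2 - s) * P2h + s * A2h) ≤
          I3l + 2 * f2l + 2 * s2l + (2 - s) * p2l + s * a2l ∧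
        1 * (I6h + 2 * F1h + 2 * L1h + (2 - s) * P1h + s * A1h) * (t₃ - t₂) ≤
          (t₃ - t₂) * (I3l + 2 * f2l + 2 * s2l + (2 - s) * p2l + s * a2l) +
            (t₂ - t₁) * ((I3l + 2 * f2l + 2 * s2l + (2 - s) * p2l + s * a2l) -
              (I3h + 2 * f3h + 2 * s3h + (2 - s) * p3h + s * a3h)))
    (c : ℝ) (hc : 0 < c) (hc1 : t₁ ≤ c ^ 2) (hc2 : c ^ 2 ≤ t₂) (p q : ℝ) (hp : p = 0 ∨ p = 1)
    (hq : q = 0 ∨ q = 1) :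
    (47 / 50 : ℝ) ^ 6 * (2 * barlowBaseEnergy (fun r => (r ^ 2)⁻¹ ^ 3) 1 c +
        (p + q) * barlowCoupling (fun r => (r ^ 2)⁻¹ ^ 3) 1 c 2 +
        2 * ∑' k : ℕ, barlowCoupling (fun r => (r ^ 2)⁻¹ ^ 3) 1 c (k + 3)) ≤
      2 * barlowBaseEnergy (fun r => (r ^ 2)⁻¹ ^ 6) 1 c + (p + q) * barlowCoupling (fun r => (r ^ 2)⁻¹ ^ 6) 1 c 2 ∧
    2 * barlowBaseEnergy (fun r => (r ^ 2)⁻¹ ^ 6) 1 c + (p + q) * barlowCoupling (fun r => (r ^ 2)⁻¹ ^ 6) 1 c 2 +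
        2 * ∑' k : ℕ, barlowCoupling (fun r => (r ^ 2)⁻¹ ^ 6) 1 c (k + 3) ≤
      2 * barlowBaseEnergy (fun r => (r ^ 2)⁻¹ ^ 3) 1 c + (p + q) * barlowCoupling (fun r => (r ^ 2)⁻¹ ^ 3) 1 c 2 := by
  obtain ⟨hs, hs0, hs2⟩ := env_s_cases hp hq
  obtain ⟨cA2, cA1, cB2, cB1⟩ := chk (p + q) hs
  rw [env_U_eq (n := 3) le_rfl hc, env_U_eq (n := 6) (by norm_num) hc, env_L_eq (n := 6) (by norm_num) hc,
    env_L_eq (n := 3) le_rfl hc]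
  set t := c ^ 2 with ht
  have ht0 : 0 < t := by positivity
  have h3 : (3 : ℕ) ≤ 3 := le_rfl
  have h6 : (3 : ℕ) ≤ 6 := by norm_num
  have hα : 0 ≤ t₂ - t := by linarith
  have hβ : 0 ≤ t - t₁ := by linarith
  have hγ : 0 ≤ t₃ - t := by linarith
  constructor
  · have hU1 := envU_le_of_bounds (e := 3) hs0 hs2 hI.2.1 G1.2.1 G1.2.2.2.2.2.2.2.2.2 G1.2.2.2.1 G1.2.2.2.2.2.1
    have hU2 := envU_le_of_bounds (e := 3) hs0 hs2 hI.2.1 G2.2.1 G2.2.2.2.2.2.2.2.2.2 G2.2.2.2.1 G2.2.2.2.2.2.1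
    have hL2 := env_le_envL_of_bounds (e := 6) hs0 hs2 hI.2.2.1 H2.1 H2.2.2.2.2.2.2.1 H2.2.2.1 H2.2.2.2.2.1
    have hL3 := envL_le_of_bounds (e := 6) hs0 hs2 hI.2.2.2 H3.2.1 H3.2.2.2.2.2.2.2.1 H3.2.2.2.1 H3.2.2.2.2.2.1
    have hch := envU_chord h3 h0 h12 hc1 hc2 hs0 hs2
    have hex := envL_ext h6 ht0 hc2 h23 hs0 hs2
    refine env_lin_core h12 h23 hc1 hc2 (by positivity) ?_ ?_ cA2 cA1
    · calc (t₂ - t₁) * envU 3 t (p + q) ≤ (t₂ - t) * envU 3 t₁ (p + q) + (t - t₁) * envU 3 t₂ (p + q) := hch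
        _ ≤ _ := add_le_add (mul_le_mul_of_nonneg_left hU1 hα) (mul_le_mul_of_nonneg_left hU2 hβ)
    · have h1 := mul_le_mul_of_nonneg_left hL2 hγ
      have h2 := mul_le_mul_of_nonneg_left hL3 hα
      linarith
  · have hU1 := envU_le_of_bounds (e := 6) hs0 hs2 hI.2.2.2 H1.2.1 H1.2.2.2.2.2.2.2.2.2 H1.2.2.2.1 H1.2.2.2.2.2.1
    have hU2 := envU_le_of_bounds (e := 6) hs0 hs2 hI.2.2.2 H2.2.1 H2.2.2.2.2.2.2.2.2.2 H2.2.2.2.1 H2.2.2.2.2.2.1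
    have hL2 := env_le_envL_of_bounds (e := 3) hs0 hs2 hI.1 G2.1 G2.2.2.2.2.2.2.1 G2.2.2.1 G2.2.2.2.2.1
    have hL3 := envL_le_of_bounds (e := 3) hs0 hs2 hI.2.1 G3.2.1 G3.2.2.2.2.2.2.2.1 G3.2.2.2.1 G3.2.2.2.2.2.1
    have hch := envU_chord h6 h0 h12 hc1 hc2 hs0 hs2
    have hex := envL_ext h3 ht0 hc2 h23 hs0 hs2
    have key : 1 * envU 6 t (p + q) ≤ envL 3 t (p + q) := by
      refine env_lin_core h12 h23 hc1 hc2 zero_le_one ?_ ?_ cB2 cB1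
      · calc (t₂ - t₁) * envU 6 t (p + q) ≤ (t₂ - t) * envU 6 t₁ (p + q) + (t - t₁) * envU 6 t₂ (p + q) := hch
          _ ≤ _ := add_le_add (mul_le_mul_of_nonneg_left hU1 hα) (mul_le_mul_of_nonneg_left hU2 hβ)
      · have h1 := mul_le_mul_of_nonneg_left hL2 hγ
        have h2 := mul_le_mul_of_nonneg_left hL3 hα
        linarith
    simpa using key

end Summit.AtomisticToContinuum.Crystallization.Theorems.PeriodicWindowsSketch

end
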